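import Literature.NumberTheory.ComplexMultiplication.PrimePowerBlockNondegenerate
import Literature.AlgebraicGeometry.Pohlmann1968.NondegenerateCMTypeHodgeConjecture
import Literature.AlgebraicGeometry.ComplexMultiplication.SimpleIffPrimitiveCMType
import Literature.AlgebraicGeometry.ComplexMultiplication.CMAbelianVarietyRealisedHolds
import Literature.NumberTheory.ComplexMultiplication.CMTypeBasic
import HarnessLib

/-!
# CM fields `K ⊇ k` (imaginary quadratic), `[K : k] = n ≥ 3` ARBITRARY: the `2n` CM types of weight `1` or
# `n − 1` over `k` are NONDEGENERATE — every such `K` is the CM field of a simple abelian variety all of whose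
# powers satisfy the Hodge conjecture

COR-CM (cell `pub-hodgecm2`), literature seat `lit-deligne-3` (gen 11, claim PRIME-POWER-WEIGHT), count-neutral
own lane; companion of `CorCM/PrimePowerBlock/Nondegenerate.lean` (there: `[K : k] = p^j`, weight prime to `p`).
NEW AS STATED, hence under `Summits/`.  KERNEL ONLY: theorems; no definition, no named fact, no `sorry`.  HC_CM is
NOT proved and nothing here implies it.

In Dodson's description [Dodson1984, §3.1.1] of the types of a CM field `K` containing an imaginary quadratic field
`k` — a type `Φ` is the induced type `E₀` (the embeddings extending a fixed embedding of `k`) with the embeddings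
in `f = E₀ ∖ Φ` flipped, and `Rank(Φ) = r + 1` with `r` the rank of the `G₀ = Gal(K₀ᶜ/ℚ)`-translates of `f`
(constant weight criterion, `|f| ∉ {0, n/2}`; tree `IsCMTypeWith.typeRank_eq_typeRank_stabilizer_add_one`) — the
weight-ONE vectors `f = {x}` have `r = n` for EVERY transitive `G₀`: their translates are all the coordinate
vectors.  Hence (`n ≠ 2`):

* `typeRank_stabilizer_eq_ncard_of_ncard_eq_one` — `r = n` for `|f| = 1`;
* **`typeRank_eq_of_ncard_diff_eq_one`**, `typeRank_eq_of_ncard_inter_eq_one` — (W)-level: `|E₀ ∖ Φ| = 1` or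
  `|E₀ ∩ Φ| = 1` (weight `n − 1`, read over the block `ρE₀`) ⟹ `Rank(Φ) = |E|/2 + 1`;
* number fields (`Φ₀` a CM type of `K` with quadratic reflex field, `[K : ℚ] ≥ 6`):
  **`isNondegenerate_of_ncard_diff_eq_one`**, `isNondegenerate_of_ncard_inter_eq_one`, `isNondegenerate_flip` (the
  type `Φ₀` with one place flipped, tree `CMTypeOps.flip`), `isNondegenerate_of_ncard_eq_one_of_ringHom`;
* abelian varieties: `hodgeConjectureFor_pow_of_ncard_diff_eq_one` and **`exists_isSimple_hodgeConjectureFor_pow`**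
  — every CM field of degree `≥ 6` containing an imaginary quadratic field is the CM field of a SIMPLE abelian
  variety `A` (a realisation of `flip φ Φ₀`, which exist by Shimura §6.2 Thm. 3, tree `exists_isCMTypeRealisation`)
  such that `A` and ALL ITS POWERS satisfy the Hodge conjecture, unconditionally (Pohlmann–White–Hazama, tree
  `IsNondegenerate.hodgeConjectureFor_pow`).

(For `n = 2` the weight-one types of a biquadratic CM field are the lifts from its other imaginary quadratic
subfield: degenerate — the hypothesis `n ≠ 2` is sharp.)

## References
* [Dodson1984] B. Dodson, *The structure of Galois groups of CM-fields*, Trans. AMS 283 (1984), §3.1.1 Theorem.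
* [Dodson1987] B. Dodson, J. Algebra 111 (1987), Thm. 1.0 (i) ("`n + 1 ∈ S(n)`, for every `n`").
* [Gordon1999HodgeAVSurvey] B. B. Gordon, *A survey of the Hodge conjecture for abelian varieties*, Thm. 6.4, §9.3.
* [Shimura1998] G. Shimura, *Abelian varieties with complex multiplication and modular functions*, §6.2 Thm. 3,
  §8.2 Prop. 26.

Provenance: Literature home (namespace `Literature.AlgebraicGeometry.ComplexMultiplication.PrimePowerBlock`) of the Summits-side `CorCM/PrimePowerBlock/WeightOne` (cell `pub-hodgecm2`, COR-CM; all its imports are `Literature/`, Mathlib and the already re-homed `Nondegenerate`), which `Literature/` may not import; theorems only, no named fact, no definition. Nothing here bears on `HC_CM`. Lane `lit-hodgefound` (Layer A3: CM types, their Kubota ranks and Galois combinatorics), seat p20.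
-/

set_option autoImplicit false

open scoped BigOperators Pointwise

namespace Literature.AlgebraicGeometry.ComplexMultiplication.PrimePowerBlock

open Literature.NumberTheory.ComplexMultiplication.PrimePowerBlock

open Literature.NumberTheory.ComplexMultiplication

/-! ### §1 Group level: weight one over a block -/

section Block

variable {G : Type*} [Group G] {E : Type*} [MulAction G E] {ρ : G} {Φ E₀ : Set E}

/-- **`r = n` for a weight-one vector**: the `G₀ = Stab(E₀)`-translates of a singleton `{x₀} ⊆ E₀` are all the
coordinate vectors of the points of `E₀` (`G₀` is transitive on `E₀`), so they span the functions supported on `E₀`.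
[cite: Dodson1984, §3.1.1 Theorem] -/
theorem typeRank_stabilizer_eq_ncard_of_ncard_eq_one [Fintype E] [MulAction.IsPretransitive G E]
    (h₀ : IsCMTypeWith ρ E₀) (hG : ∀ g : G, g • E₀ = E₀ ∨ g • E₀ = ρ • E₀) {f : Set E} (hfE : f ⊆ E₀)
    (hf : f.ncard = 1) : typeRank (MulAction.stabilizer G E₀) f = E₀.ncard := by
  classical
  obtain ⟨x₀, rfl⟩ := Set.ncard_eq_one.1 hf
  have hx₀ : x₀ ∈ E₀ := hfE rfl
  set H := MulAction.stabilizer G E₀ with hH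
  haveI : MulAction.IsPretransitive H E₀ := h₀.isPretransitive_stabilizer_of_block hG
  -- the coordinate vectors
  let e : E → E → ℚ := fun y x => if x = y then 1 else 0
  have htr : ∀ m : H, translateInd ({x₀} : Set E) m = e ((m : G)⁻¹ • x₀) := fun m => by
    funext x
    have hiff : m • x ∈ ({x₀} : Set E) ↔ x = (m : G)⁻¹ • x₀ := by
      rw [Set.mem_singleton_iff, eq_inv_smul_iff]; exact Iff.rfl
    by_cases hx : m • x ∈ ({x₀} : Set E)
    · rw [translateInd_of_mem hx]; exact (if_pos (hiff.1 hx)).symm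
    · rw [translateInd_of_not_mem hx]; exact (if_neg fun h => hx (hiff.2 h)).symm
  have hrange : Set.range (fun m : H => translateInd ({x₀} : Set E) m) = Set.range (fun y : E₀ => e y) := by
    ext u
    constructor
    · rintro ⟨m, rfl⟩
      have hmem : (m : G)⁻¹ • x₀ ∈ E₀ := by
        have h1 : ((m⁻¹ : H) : G) • E₀ = E₀ := (m⁻¹).2
        rw [Subgroup.coe_inv] at h1
        rw [← h1]; exact Set.smul_mem_smul_set hx₀
      exact ⟨⟨(m : G)⁻¹ • x₀, hmem⟩, (htr m).symm⟩
    · rintro ⟨y, rfl⟩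
      obtain ⟨m, hm⟩ := MulAction.exists_smul_eq H y ⟨x₀, hx₀⟩
      refine ⟨m, ?_⟩
      have h1 : (m : G) • (y : E) = x₀ := congrArg Subtype.val hm
      change translateInd ({x₀} : Set E) m = e y
      rw [htr m, ← h1, inv_smul_smul]
  have hli : LinearIndependent ℚ (fun y : E₀ => e y) := by
    have he : (fun y : E₀ => e y) = (fun x : E => (Pi.basisFun ℚ E) x) ∘ Subtype.val := by
      funext y
      funext x
      simp only [e, Function.comp_apply, Pi.basisFun_apply, Pi.single_apply]
    rw [he]
    exact (Pi.basisFun ℚ E).linearIndependent.comp _ Subtype.val_injective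
  rw [typeRank, hrange, finrank_span_eq_card hli, Set.ncard_eq_toFinset_card', Set.toFinset_card]

/-- **Weight ONE over a block ⟹ NONDEGENERATE** (`n = |E₀| ≠ 2`): `|E₀ ∖ Φ| = 1 ⟹ Rank(Φ) = |E|/2 + 1`, for every
transitive `G` and every block `E₀` (`gE₀ ∈ {E₀, ρE₀}`). [cite: Dodson1984, §3.1.1 Theorem] -/
theorem typeRank_eq_of_ncard_diff_eq_one [Fintype E] [Nonempty E] [Finite G] [MulAction.IsPretransitive G E]
    (h : IsCMTypeWith ρ Φ) (h₀ : IsCMTypeWith ρ E₀) (hG : ∀ g : G, g • E₀ = E₀ ∨ g • E₀ = ρ • E₀)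
    (hf : (E₀ \ Φ).ncard = 1) (hn : E₀.ncard ≠ 2) : typeRank G Φ = Fintype.card E / 2 + 1 := by
  have hw0 : ¬ E₀ ⊆ Φ := fun hsub => by
    rw [Set.sdiff_eq_empty.2 hsub, Set.ncard_empty] at hf; exact zero_ne_one hf
  have h2 : 2 * (E₀ \ Φ).ncard ≠ E₀.ncard := by rw [hf]; omega
  rw [h.typeRank_eq_typeRank_stabilizer_add_one h₀ hG h2 hw0,
    typeRank_stabilizer_eq_ncard_of_ncard_eq_one h₀ hG Set.sdiff_subset hf]
  have hE : 2 * E₀.ncard = Fintype.card E := by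
    rw [← Nat.card_eq_fintype_card]; exact two_mul_ncard_eq_card_of_cm h₀.mem_iff
  omega

/-- `ρE₀ ∖ Φ = ρ(E₀ ∩ Φ)`: the weight of `Φ` over the conjugate block is `|E₀ ∩ Φ|`. [cite: Dodson1984, §3.1.1 Theorem] -/
private theorem rho_smul_set_diff_eq (h : IsCMTypeWith ρ Φ) : ρ • E₀ \ Φ = ρ • (E₀ ∩ Φ) := by
  ext x
  have hinv : ρ⁻¹ • x = ρ • x := inv_smul_eq_iff.2 (h.invol x).symm
  rw [Set.mem_sdiff, Set.mem_smul_set_iff_inv_smul_mem, Set.mem_smul_set_iff_inv_smul_mem, hinv, Set.mem_inter_iff,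
    h.rho_smul_mem_iff x]

/-- **Weight `n − 1` over a block ⟹ NONDEGENERATE** (`n ≠ 2`): `|E₀ ∩ Φ| = 1 ⟹ Rank(Φ) = |E|/2 + 1` (weight one over
the conjugate block `ρE₀`). [cite: Dodson1984, §3.1.1 Theorem] -/
theorem typeRank_eq_of_ncard_inter_eq_one [Fintype E] [Nonempty E] [Finite G] [MulAction.IsPretransitive G E]
    (h : IsCMTypeWith ρ Φ) (h₀ : IsCMTypeWith ρ E₀) (hG : ∀ g : G, g • E₀ = E₀ ∨ g • E₀ = ρ • E₀)
    (hf : (E₀ ∩ Φ).ncard = 1) (hn : E₀.ncard ≠ 2) : typeRank G Φ = Fintype.card E / 2 + 1 := by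
  have h₀' : IsCMTypeWith ρ (ρ • E₀) := h₀.smul_set ρ
  have hG' : ∀ g : G, g • ρ • E₀ = ρ • E₀ ∨ g • ρ • E₀ = ρ • ρ • E₀ := fun g => by
    have hcomm : g • ρ • E₀ = ρ • g • E₀ := by
      rw [smul_smul, smul_smul]
      ext x
      rw [Set.mem_smul_set_iff_inv_smul_mem, Set.mem_smul_set_iff_inv_smul_mem, mul_inv_rev, mul_inv_rev,
        mul_smul, mul_smul]
      have hρinv : ∀ y : E, ρ⁻¹ • y = ρ • y := fun y => inv_smul_eq_iff.2 (h₀.invol y).symm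
      rw [hρinv, hρinv, h₀.comm]
    rw [hcomm]
    rcases hG g with h1 | h1
    · left; rw [h1]
    · right; rw [h1]
  have hf' : (ρ • E₀ \ Φ).ncard = 1 := by rw [rho_smul_set_diff_eq h, Set.ncard_smul_set, hf]
  have hn' : (ρ • E₀).ncard ≠ 2 := by rwa [Set.ncard_smul_set]
  exact typeRank_eq_of_ncard_diff_eq_one h h₀' hG' hf' hn'

end Block

/-! ### §2 Number fields -/

section NumberField

open NumberField
open Literature.AlgebraicGeometry.Motives (CMType)
open Literature.AlgebraicGeometry.Pohlmann1968 (cmTypeRank IsNondegenerate)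

variable {K : Type} [Field K] [NumberField K]
variable {L : Type} [Field L] [NumberField L] [IsCMField L] [IsGalois ℚ L]

/-- **Weight one over the imaginary quadratic subfield ⟹ NONDEGENERATE** (`[K : ℚ] ≥ 6`): for `Φ₀` a CM type of
`K` with quadratic reflex field and `Φ` a CM type with `|Φ₀ ∖ Φ| = 1`, `Rank(Φ) = [K:ℚ]/2 + 1`.
[cite: Dodson1984, §3.1.1 Theorem] -/
theorem isNondegenerate_of_ncard_diff_eq_one (j : K →ₐ[ℚ] L) (ι : L →+* ℂ) (Φ₀ Φ : CMType K)
    (h2 : Module.finrank ℚ (reflexField ℚ L (algValuedIn ι Φ₀.1)) = 2) (h6 : 6 ≤ Module.finrank ℚ K)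
    (hf : (Φ₀.1 \ Φ.1).ncard = 1) : IsNondegenerate Φ := by
  haveI : Nonempty (K →ₐ[ℚ] L) := ⟨j⟩
  have h₀ := isCMTypeWith_conjGal_algValuedIn ι Φ₀
  have h := isCMTypeWith_conjGal_algValuedIn ι Φ
  have hG := smul_algValuedIn_eq_or_of_finrank_reflexField_eq_two j ι Φ₀ h2
  have hn : (algValuedIn ι Φ₀.1).ncard ≠ 2 := by
    rw [ncard_algValuedIn j ι, ncard_cmType_eq]; omega
  have hsd : algValuedIn ι Φ₀.1 \ algValuedIn ι Φ.1 = algValuedIn ι (Φ₀.1 \ Φ.1) := rfl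
  rw [isNondegenerate_iff_typeRank_algValuedIn j ι Φ]
  exact typeRank_eq_of_ncard_diff_eq_one h h₀ hG (by rw [hsd, ncard_algValuedIn j ι, hf]) hn

/-- **Weight `n − 1` (`|Φ₀ ∩ Φ| = 1`) ⟹ NONDEGENERATE** (`[K : ℚ] ≥ 6`). [cite: Dodson1984, §3.1.1 Theorem] -/
theorem isNondegenerate_of_ncard_inter_eq_one (j : K →ₐ[ℚ] L) (ι : L →+* ℂ) (Φ₀ Φ : CMType K)
    (h2 : Module.finrank ℚ (reflexField ℚ L (algValuedIn ι Φ₀.1)) = 2) (h6 : 6 ≤ Module.finrank ℚ K)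
    (hf : (Φ₀.1 ∩ Φ.1).ncard = 1) : IsNondegenerate Φ := by
  haveI : Nonempty (K →ₐ[ℚ] L) := ⟨j⟩
  have h₀ := isCMTypeWith_conjGal_algValuedIn ι Φ₀
  have h := isCMTypeWith_conjGal_algValuedIn ι Φ
  have hG := smul_algValuedIn_eq_or_of_finrank_reflexField_eq_two j ι Φ₀ h2
  have hn : (algValuedIn ι Φ₀.1).ncard ≠ 2 := by
    rw [ncard_algValuedIn j ι, ncard_cmType_eq]; omega
  have hsi : algValuedIn ι Φ₀.1 ∩ algValuedIn ι Φ.1 = algValuedIn ι (Φ₀.1 ∩ Φ.1) := rfl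
  rw [isNondegenerate_iff_typeRank_algValuedIn j ι Φ]
  exact typeRank_eq_of_ncard_inter_eq_one h h₀ hG (by rw [hsi, ncard_algValuedIn j ι, hf]) hn

omit [NumberField K] in
/-- The type `Φ₀` with the place of `φ ∈ Φ₀` flipped differs from `Φ₀` exactly at `φ`: `Φ₀ ∖ Φ₀^{(φ)} = {φ}`.
[cite: Dodson1984, §3.1.1 Theorem] -/
private theorem diff_flip_eq (Φ₀ : CMType K) {φ : K →+* ℂ} (hφ : φ ∈ Φ₀.1) : Φ₀.1 \ (CMTypeOps.flip φ Φ₀).1 = {φ} := by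
  ext ψ
  rw [Set.mem_sdiff, CMTypeOps.mem_flip_iff, Set.mem_singleton_iff]
  constructor
  · rintro ⟨hψ, hnot⟩
    have hpl : ψ ∈ CMTypeOps.placeSet φ := by
      by_contra hpl; exact hnot (Or.inl ⟨hψ, hpl⟩)
    rcases hpl with h | h
    · exact h
    · exact absurd hψ (h ▸ (CMTypeOps.mem_iff_conjugate_notMem Φ₀ φ).1 hφ)
  · rintro rfl
    refine ⟨hφ, fun h => ?_⟩
    rcases h with ⟨_, hpl⟩ | ⟨_, hnm⟩
    · exact hpl (Or.inl rfl)
    · exact hnm hφ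

/-- **The flipped type `Φ₀^{(φ)}` is NONDEGENERATE** (`φ ∈ Φ₀`, `[K : ℚ] ≥ 6`). [cite: Dodson1984, §3.1.1 Theorem] -/
theorem isNondegenerate_flip (j : K →ₐ[ℚ] L) (ι : L →+* ℂ) (Φ₀ : CMType K)
    (h2 : Module.finrank ℚ (reflexField ℚ L (algValuedIn ι Φ₀.1)) = 2) (h6 : 6 ≤ Module.finrank ℚ K)
    {φ : K →+* ℂ} (hφ : φ ∈ Φ₀.1) : IsNondegenerate (CMTypeOps.flip φ Φ₀) :=
  isNondegenerate_of_ncard_diff_eq_one j ι Φ₀ _ h2 h6 (by rw [diff_flip_eq Φ₀ hφ, Set.ncard_singleton])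

/-- **Every CM field of degree `≥ 6` with a type of quadratic reflex field (i.e. containing an imaginary quadratic
field) has a NONDEGENERATE CM type** — hence a primitive one ([Dodson1987] Thm. 1.0 (i) "`n + 1 ∈ S(n)`" for these
fields). [cite: Dodson1987, Thm. 1.0 (i)] [cite: Dodson1984, §3.1.1 Theorem] -/
theorem exists_isNondegenerate (j : K →ₐ[ℚ] L) (ι : L →+* ℂ) (Φ₀ : CMType K)
    (h2 : Module.finrank ℚ (reflexField ℚ L (algValuedIn ι Φ₀.1)) = 2) (h6 : 6 ≤ Module.finrank ℚ K) :
    ∃ Φ : CMType K, IsNondegenerate Φ := by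
  have hne : Φ₀.1.Nonempty := by
    rw [← Set.ncard_pos (Set.toFinite _), ncard_cmType_eq]; omega
  obtain ⟨φ, hφ⟩ := hne
  exact ⟨CMTypeOps.flip φ Φ₀, isNondegenerate_flip j ι Φ₀ h2 h6 hφ⟩

/-! ### Over an explicit imaginary quadratic subfield `k : k₀ →+* K` -/

section ImaginaryQuadratic

variable {k₀ : Type} [Field k₀] [NumberField k₀] [IsTotallyComplex k₀]

omit [NumberField K] in
/-- `Φ₀ ∖ Φ = {φ ∉ Φ | φ ∘ k = ψ₀}` for the block `Φ₀` induced from `(k₀, {ψ₀})`. [cite: Dodson1984, §3.1.1 Theorem] -/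
private theorem inducedCMType_single_diff' (hk2 : Module.finrank ℚ k₀ = 2) (k : k₀ →+* K) (ψ₀ : k₀ →+* ℂ)
    (Φ : CMType K) :
    (inducedCMType k (CMTypeCount.single hk2 ψ₀)).1 \ Φ.1 = {φ : K →+* ℂ | φ ∉ Φ.1 ∧ φ.comp k = ψ₀} := by
  ext φ
  simp only [Set.mem_sdiff, mem_inducedCMType_iff, CMTypeCount.single_val, Set.mem_singleton_iff,
    Set.mem_setOf_eq]
  tauto

/-- **`K ⊇ k`, `[K : ℚ] ≥ 6`: a CM type with exactly ONE embedding over `ψ₀` outside it — `|{φ ∉ Φ | φ ∘ k = ψ₀}| = 1`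
— is nondegenerate.** [cite: Dodson1984, §3.1.1 Theorem] -/
theorem isNondegenerate_of_ncard_eq_one_of_ringHom (hk2 : Module.finrank ℚ k₀ = 2) (k : k₀ →+* K)
    (j : K →ₐ[ℚ] L) (ι : L →+* ℂ) (ψ₀ : k₀ →+* ℂ) (Φ : CMType K) (h6 : 6 ≤ Module.finrank ℚ K)
    (hf : {φ : K →+* ℂ | φ ∉ Φ.1 ∧ φ.comp k = ψ₀}.ncard = 1) : IsNondegenerate Φ := by
  rw [← inducedCMType_single_diff' hk2 k ψ₀ Φ] at hf
  exact isNondegenerate_of_ncard_diff_eq_one j ι _ Φ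
    (finrank_reflexField_algValuedIn_inducedCMType_single hk2 k j ι ψ₀) h6 hf

/-- **`K ⊇ k`, `[K : ℚ] ≥ 6`: `K` has a nondegenerate CM type.** [cite: Dodson1987, Thm. 1.0 (i)]
[cite: Dodson1984, §3.1.1 Theorem] -/
theorem exists_isNondegenerate_of_ringHom (hk2 : Module.finrank ℚ k₀ = 2) (k : k₀ →+* K) (j : K →ₐ[ℚ] L)
    (ι : L →+* ℂ) (ψ₀ : k₀ →+* ℂ) (h6 : 6 ≤ Module.finrank ℚ K) : ∃ Φ : CMType K, IsNondegenerate Φ :=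
  exists_isNondegenerate j ι _ (finrank_reflexField_algValuedIn_inducedCMType_single hk2 k j ι ψ₀) h6

end ImaginaryQuadratic

end NumberField

/-! ### §3 Abelian varieties -/

section Geometry

open _root_.CategoryTheory NumberField
open Literature.AlgebraicGeometry.Motives (AbelianVariety CMType)
open Literature.AlgebraicGeometry.HodgeTheory
open Literature.AlgebraicGeometry.ComplexMultiplication (IsCMTypeRealisation isSimple_iff_isPrimitive
  exists_isCMTypeRealisation)
open Literature.AlgebraicGeometry.Pohlmann1968

variable {K : Type} [Field K] [NumberField K] [IsCMField K]
variable {L : Type} [Field L] [NumberField L] [IsCMField L] [IsGalois ℚ L]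
variable {Φ : CMType K} {A : AbelianVariety ℂ} {ι : 𝓞 K →+* End A} {θ : K →+* Module.End ℂ (complexBetti A.X 1)}

/-- **Weight one over the imaginary quadratic subfield: the Hodge conjecture for ALL POWERS** of every realisation
(`[K : ℚ] ≥ 6`), unconditionally. [cite: Dodson1984, §3.1.1 Theorem] [cite: Gordon1999HodgeAVSurvey, Thm. 6.4 and §9.3] -/
theorem hodgeConjectureFor_pow_of_ncard_diff_eq_one (j : K →ₐ[ℚ] L) (ιL : L →+* ℂ) (Φ₀ : CMType K)
    (h2 : Module.finrank ℚ (reflexField ℚ L (algValuedIn ιL Φ₀.1)) = 2) (h6 : 6 ≤ Module.finrank ℚ K)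
    (hf : (Φ₀.1 \ Φ.1).ncard = 1) (hA : IsCMTypeRealisation Φ A ι θ) (r : ℕ) :
    HodgeConjectureFor (⨁ fun _ : Fin r => A).dim (⨁ fun _ : Fin r => A).X :=
  (isNondegenerate_of_ncard_diff_eq_one j ιL Φ₀ Φ h2 h6 hf).hodgeConjectureFor_pow hA r

/-- **Weight one: the realisations are SIMPLE** (nondegenerate ⟹ primitive). [cite: Dodson1984, §3.1.1 Theorem]
[cite: Shimura1998, §8.2 Prop. 26] -/
theorem isSimple_of_ncard_diff_eq_one (j : K →ₐ[ℚ] L) (ιL : L →+* ℂ) (Φ₀ : CMType K)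
    (h2 : Module.finrank ℚ (reflexField ℚ L (algValuedIn ιL Φ₀.1)) = 2) (h6 : 6 ≤ Module.finrank ℚ K)
    (hf : (Φ₀.1 \ Φ.1).ncard = 1) (hA : IsCMTypeRealisation Φ A ι θ) (φ₀ : K →+* ℂ) : A.IsSimple :=
  (isSimple_iff_isPrimitive hA φ₀).2 ((isNondegenerate_of_ncard_diff_eq_one j ιL Φ₀ Φ h2 h6 hf).isPrimitive φ₀)

/-- **Every CM field of degree `≥ 6` containing an imaginary quadratic field is the CM field of a SIMPLE abelian
variety all of whose powers satisfy the Hodge conjecture** (a realisation of a weight-one type — realisations exist,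
Shimura §6.2 Thm. 3, tree `exists_isCMTypeRealisation`), unconditionally. [cite: Dodson1987, Thm. 1.0 (i)]
[cite: Shimura1998, §6.2 Thm. 3] [cite: Gordon1999HodgeAVSurvey, Thm. 6.4 and §9.3] -/
theorem exists_isSimple_hodgeConjectureFor_pow (j : K →ₐ[ℚ] L) (ιL : L →+* ℂ) (Φ₀ : CMType K)
    (h2 : Module.finrank ℚ (reflexField ℚ L (algValuedIn ιL Φ₀.1)) = 2) (h6 : 6 ≤ Module.finrank ℚ K) :
    ∃ (Ψ : CMType K) (B : AbelianVariety ℂ) (ι' : 𝓞 K →+* End B)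
      (θ' : K →+* Module.End ℂ (complexBetti B.X 1)),
      IsCMTypeRealisation Ψ B ι' θ' ∧ B.IsSimple ∧ B.dim = Module.finrank ℚ K / 2 ∧
        ∀ r : ℕ, HodgeConjectureFor (⨁ fun _ : Fin r => B).dim (⨁ fun _ : Fin r => B).X := by
  obtain ⟨Ψ, hΨ⟩ := exists_isNondegenerate j ιL Φ₀ h2 h6
  obtain ⟨B, ι', θ', hB⟩ := exists_isCMTypeRealisation Ψ
  obtain ⟨φ₀⟩ : Nonempty (K →+* ℂ) := inferInstance
  exact ⟨Ψ, B, ι', θ', hB, (isSimple_iff_isPrimitive hB φ₀).2 (hΨ.isPrimitive φ₀),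
    Literature.AlgebraicGeometry.Motives.schemeDim_eq_holds hB.1, fun r => hΨ.hodgeConjectureFor_pow hB r⟩

end Geometry

end Literature.AlgebraicGeometry.ComplexMultiplication.PrimePowerBlock
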